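import Literature.Computation.Certificates.PsdRoundedTwinGramL

/-!
# Rounded-twin PSD lane with the twin shipped as PACKED row numerals

Compute-infrastructure file (certnum L4; gridfusion #50 «G2.a-K2A-alg-deg4» next-wave PSD lane,
2026-08-27). Measured on the farm (#50's 189-block): a twin-row DATA file of 11 900 `ℤ` list-literal
entries ELABORATES in ≈ 69 s (≈ 5.8 ms per `ℤ` entry; `ℚ` entries ≈ 1.5 ms, `ℕ` ≈ 0.9 ms), whereas the
same rows as PACKED naturals (one numeral of `w`-bit offset digits per row — the row format of
`PSD.Packed.checkRows`, `PackedGramCertificateRows.lean`) elaborate in seconds and are consumed by the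
packed DD check DIRECTLY (no in-kernel packing; 507 KB of such numerals + a 78-row DD walk: 21.8 s).
So the cheap transport of a rounded twin is its packed row literals `Arows : List ℕ`: the twin matrix
is `PSD.Packed.intMatrixRows n w Arows` (entries by `PSD.Packed.rowEntry`, one shift + one `mod`), its
integer Gram certificate is `PSD.Packed.isGramCertZ_of_checkRows` / `…_of_checkRowsRanges` unchanged,
and the only new kernel pass is the entrywise CLOSENESS of the client's rational rows to the packed
rows — `PSD.closeRangeP` below, built on the same `ℕ`-arithmetic entry test `PSD.closeEntryN` as
`PsdRoundedTwin.lean`. The perturbation step `PSD.quadForm_nonneg_of_twinMatrix_of_close` is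
`quadForm_nonneg_of_roundedTwin_of_close` with the twin an ABSTRACT integer matrix; the `SOS.GramL`
entry points `quadNonneg_of_packedTwinRows_ranges` / `…_split` make an emitted block proof one term.
[cite: Rump1999VerifiedLargeSystems, §4 Algorithm 4.1 step 7]

WHAT THIS FILE DOES NOT CERTIFY: existence of a twin (near-singular blocks have none — exact lanes);
anything beyond `QuadNonneg` of the block; the identity side. The file-private semantics lemmas of
`PsdRoundedTwin.lean` (`closeEntryN`, `sgnMag`) are re-proved here locally rather than exported.
-/

namespace Literature.Computation.Certificates

namespace PSD

/-! ### Closeness of rational rows to PACKED integer rows -/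

/-- Walk one rational row against the packed twin row literal `Ai` (`w`-bit offset digits; entry `j`
is `Packed.rowEntry w Ai j`), entries `j, j+1, …` (fuel-indexed). [folklore] -/
def closeRowP (w S s e i Ai : ℕ) : ℕ → ℕ → List ℚ → Bool
  | 0, _, _ => true
  | fuel + 1, j, qrow =>
      closeEntryN S s e i j (qrow.headD 0) (Packed.rowEntry w Ai j) && closeRowP w S s e i Ai fuel (j + 1) qrow.tail

/-- Walk the rows `i, i+1, …` (fuel-indexed): rational rows against packed row literals. [folklore] -/
def closeRowsP (n w S s e : ℕ) : ℕ → ℕ → List (List ℚ) → List ℕ → Bool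
  | 0, _, _, _ => true
  | fuel + 1, i, Qrows, Arows =>
      closeRowP w S s e i (Arows.headD 0) n 0 (Qrows.headD []) &&
        closeRowsP n w S s e fuel (i + 1) Qrows.tail Arows.tail

/-- **Closeness of the ROWS `lo … lo+k−1`** of `Q = matrixOfRows n n Qrows` to the PACKED twin rows:
`|S·Q i j − (Packed.intMatrixRows n w Arows i j + s·[i = j])| ≤ e` for those rows and all `j < n`.
One `decide +kernel` per range (per file if needed). [folklore] -/
def closeRangeP (n w S s e lo k : ℕ) (Qrows : List (List ℚ)) (Arows : List ℕ) : Bool :=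
  closeRowsP n w S s e k lo (Qrows.drop lo) (Arows.drop lo)

/-- Bookkeeping for the split `V = P − N` of the entry test (local copy of the file-private lemma of
`PsdRoundedTwin.lean`). [folklore] -/
private theorem abs_le_of_split' {P N E : ℕ} {V : ℤ} (hV : V = (P : ℤ) - (N : ℤ))
    (h : (if N ≤ P then decide (P - N ≤ E) else decide (N - P ≤ E)) = true) : |V| ≤ (E : ℤ) := by
  rw [hV, abs_le]
  split at h
  · rename_i hNP
    simp only [decide_eq_true_eq] at h
    zify [hNP] at h
    constructor <;> linarith
  · rename_i hNP
    simp only [decide_eq_true_eq] at h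
    rw [not_le] at hNP
    zify [hNP.le] at h
    constructor <;> linarith

/-- `sgnMag` semantics (local copy). [folklore] -/
private theorem sgnMag_spec' (z : ℤ) :
    z = if (sgnMag z).1 then ((sgnMag z).2 : ℤ) else -((sgnMag z).2 : ℤ) := by
  cases z with
  | ofNat k => simp [sgnMag]
  | negSucc k => simp [sgnMag, Int.negSucc_eq]

/-- Semantics of the entry test `closeEntryN` (local copy of the file-private lemma of
`PsdRoundedTwin.lean`). [folklore] -/
private theorem closeEntryN_spec' {S s e i j : ℕ} {q : ℚ} {m : ℤ}
    (h : closeEntryN S s e i j q m = true) :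
    |(S : ℚ) * q - ((m : ℚ) + if i = j then (s : ℚ) else 0)| ≤ e := by
  set m' : ℤ := m + if i = j then (s : ℤ) else 0 with hm'
  have hb : (0 : ℚ) < q.den := by exact_mod_cast q.den_pos
  have key : |(S : ℤ) * q.num - m' * (q.den : ℤ)| ≤ (e : ℤ) * (q.den : ℤ) := by
    have ha := sgnMag_spec' q.num
    have hc := sgnMag_spec' m'
    simp only [closeEntryN] at h
    rw [← hm'] at h
    rcases hA : sgnMag q.num with ⟨sa, ka⟩
    rcases hCm : sgnMag m' with ⟨sc, kc⟩
    rw [hA] at h ha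
    rw [hCm] at h hc
    have hEb : ((e * q.den : ℕ) : ℤ) = (e : ℤ) * (q.den : ℤ) := by push_cast; ring
    rw [← hEb]
    cases sa <;> cases sc <;>
      simp only [Bool.false_eq_true, ↓reduceIte, zero_add, add_zero] at h ha hc <;>
      refine abs_le_of_split' ?_ h <;> (rw [ha, hc]; push_cast; ring)
  have hm'q : ((m : ℚ) + if i = j then (s : ℚ) else 0) = (m' : ℚ) := by
    rw [hm']; push_cast; rfl
  rw [hm'q]
  have hrepr : (S : ℚ) * q - (m' : ℚ) = (((S : ℤ) * q.num - m' * (q.den : ℤ) : ℤ) : ℚ) / (q.den : ℚ) := by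
    rw [eq_div_iff hb.ne']
    push_cast
    have hqd := Rat.mul_den_eq_num q
    rw [sub_mul, mul_assoc, hqd]
  rw [hrepr, abs_div, abs_of_pos hb, div_le_iff₀ hb]
  exact_mod_cast key

/-- Semantics of the packed row walk. [folklore] -/
private theorem closeRowP_spec {w S s e i Ai : ℕ} :
    ∀ (fuel j : ℕ) (qrow : List ℚ), closeRowP w S s e i Ai fuel j qrow = true →
      ∀ t, t < fuel → closeEntryN S s e i (j + t) (qrow.getD t 0) (Packed.rowEntry w Ai (j + t)) = true
  | 0, _, _, _, t, ht => by omega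
  | fuel + 1, j, qrow, h, t, ht => by
      simp only [closeRowP, Bool.and_eq_true] at h
      cases t with
      | zero =>
          simpa [List.getD_eq_getElem?_getD, List.headD_eq_head?_getD, List.head?_eq_getElem?] using h.1
      | succ t =>
          have ih := closeRowP_spec fuel (j + 1) qrow.tail h.2 t (by omega)
          simp only [List.getD_eq_getElem?_getD, List.getElem?_tail] at ih ⊢
          simpa [Nat.add_right_comm, Nat.add_assoc] using ih

/-- Semantics of the packed rows walk. [folklore] -/
private theorem closeRowsP_spec {n w S s e : ℕ} :
    ∀ (fuel i : ℕ) (Qrows : List (List ℚ)) (Arows : List ℕ),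
      closeRowsP n w S s e fuel i Qrows Arows = true →
      ∀ t, t < fuel → closeRowP w S s e (i + t) (Arows.getD t 0) n 0 (Qrows.getD t []) = true
  | 0, _, _, _, _, t, ht => by omega
  | fuel + 1, i, Qrows, Arows, h, t, ht => by
      simp only [closeRowsP, Bool.and_eq_true] at h
      cases t with
      | zero =>
          simpa [List.getD_eq_getElem?_getD, List.headD_eq_head?_getD, List.head?_eq_getElem?] using h.1
      | succ t =>
          have ih := closeRowsP_spec fuel (i + 1) Qrows.tail Arows.tail h.2 t (by omega)
          simp only [List.getD_eq_getElem?_getD, List.getElem?_tail] at ih ⊢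
          simpa [Nat.add_right_comm, Nat.add_assoc] using ih

/-- `drop`/`getD` bookkeeping (local copy). [folklore] -/
private theorem getD_drop_eq {α : Type*} (l : List α) (dflt : α) (j t : ℕ) :
    (List.drop j l).getD t dflt = l.getD (j + t) dflt := by
  rw [List.getD_eq_getElem?_getD, List.getD_eq_getElem?_getD, List.getElem?_drop]

/-- **Semantics of `closeRangeP`**: for the rows in range, the rational entries are `e/S`-close to the
packed twin's entries shifted by `s` on the diagonal (the entrywise bound `‖Δ‖` of Rump's
perturbation step). [cite: Rump1999VerifiedLargeSystems, §4 Algorithm 4.1 step 7] -/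
theorem closeRangeP_spec {n w S s e lo k : ℕ} {Qrows : List (List ℚ)} {Arows : List ℕ}
    (h : closeRangeP n w S s e lo k Qrows Arows = true) :
    ∀ i j : Fin n, lo ≤ i.val → i.val < lo + k →
      |(S : ℚ) * matrixOfRows n n Qrows i j -
          (((Packed.intMatrixRows n w Arows i j : ℤ) : ℚ) + if i = j then (s : ℚ) else 0)| ≤ e := by
  intro i j hlo hhi
  obtain ⟨t, ht⟩ : ∃ t, i.val = lo + t := ⟨i.val - lo, by omega⟩
  have htk : t < k := by omega
  have hrow := closeRowsP_spec (n := n) (w := w) (S := S) (s := s) (e := e) k lo (Qrows.drop lo)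
    (Arows.drop lo) h t htk
  rw [getD_drop_eq, getD_drop_eq] at hrow
  have hent := closeRowP_spec n 0 _ hrow j.val j.isLt
  simp only [Nat.zero_add] at hent
  have := closeEntryN_spec' hent
  rw [← ht] at this
  simpa [matrixOfRows, Packed.intMatrixRows, Fin.ext_iff] using this

/-! ### The perturbation step with an abstract integer twin matrix -/

section TwinMatrix

variable {R : Type*} [Field R] [LinearOrder R] [IsStrictOrderedRing R]

/-- **PSD by a rounded twin given as ANY integer matrix `M`** (e.g. `Packed.intMatrixRows n w Arows`):
an integer Gram certificate of `M`, entrywise closeness `|S·Q − (M + s·1)| ≤ e` as a proposition, and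
the margin `n·e ≤ s` give the nonnegative quadratic form of `Q = matrixOfRows n n Qrows`. (The proof
is that of `quadForm_nonneg_of_roundedTwin_of_close`, which is the case `M = matrixOfRows n n Mrows`.)
[cite: Rump1999VerifiedLargeSystems, §4 Algorithm 4.1 step 7] -/
theorem quadForm_nonneg_of_twinMatrix_of_close {n m S s e : ℕ} {Qrows : List (List ℚ)}
    {M : Matrix (Fin n) (Fin n) ℤ} {d : Fin m → ℕ} {B : Matrix (Fin m) (Fin n) ℤ}
    (hM : IsGramCertZ M d B) (hS : 0 < S)
    (hE : ∀ i j : Fin n, |(S : ℚ) * matrixOfRows n n Qrows i j -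
          (((M i j : ℤ) : ℚ) + if i = j then (s : ℚ) else 0)| ≤ e)
    (hmargin : n * e ≤ s) (y : Fin n → R) :
    0 ≤ ∑ i, ∑ j, y i * ((matrixOfRows n n Qrows i j : ℚ) : R) * y j := by
  let Q : Matrix (Fin n) (Fin n) R := fun i j => ((matrixOfRows n n Qrows i j : ℚ) : R)
  let C : Matrix (Fin n) (Fin n) R := fun i j => ((M i j : ℤ) : R) + if i = j then (s : R) else 0
  have hCform : ∀ z : Fin n → R, (s : R) * ∑ i, z i ^ 2 ≤ ∑ i, ∑ j, z i * C i j * z j := by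
    intro z
    have h0 := hM.quadForm_nonneg (R := R) z
    have hdiag : ∀ i : Fin n, ∑ j, z i * (if i = j then (s : R) else 0) * z j = (s : R) * z i ^ 2 := by
      intro i
      have : ∀ j : Fin n, z i * (if i = j then (s : R) else 0) * z j =
          if i = j then (s : R) * z i ^ 2 else 0 := by
        intro j; split
        · subst_vars; ring
        · ring
      simp_rw [this]
      simp
    have hsplit : ∑ i, ∑ j, z i * C i j * z j =
        (∑ i, ∑ j, z i * ((M i j : ℤ) : R) * z j) + (s : R) * ∑ i, z i ^ 2 := by
      rw [Finset.mul_sum, ← Finset.sum_add_distrib]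
      refine Finset.sum_congr rfl fun i _ => ?_
      rw [← hdiag i, ← Finset.sum_add_distrib]
      exact Finset.sum_congr rfl fun j _ => by simp only [C]; ring
    rw [hsplit]; linarith
  have hEr : ∀ i j, |((S : R) • Q) i j - C i j| ≤ (e : R) := by
    intro i j
    have h := (Rat.cast_le (K := R)).mpr (hE i j)
    rw [Rat.cast_abs] at h
    have hcast : ((((S : ℚ) * matrixOfRows n n Qrows i j -
        (((M i j : ℤ) : ℚ) + if i = j then (s : ℚ) else 0) : ℚ)) : R) =
        ((S : R) • Q) i j - C i j := by
      simp only [Q, C, Matrix.smul_apply, smul_eq_mul]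
      split <;> push_cast <;> ring
    rw [hcast] at h
    exact_mod_cast h
  have hmarginR : (n : R) * (e : R) ≤ (s : R) := by exact_mod_cast hmargin
  have hSQ := quadForm_nonneg_of_near ((S : R) • Q) C hCform hEr hmarginR y
  have hscale : ∑ i, ∑ j, y i * ((S : R) • Q) i j * y j = (S : R) * ∑ i, ∑ j, y i * Q i j * y j := by
    rw [Finset.mul_sum]
    refine Finset.sum_congr rfl fun i _ => ?_
    rw [Finset.mul_sum]
    exact Finset.sum_congr rfl fun j _ => by simp only [Matrix.smul_apply, smul_eq_mul]; ring
  rw [hscale] at hSQ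
  have hSpos : (0 : R) < (S : R) := by exact_mod_cast hS
  show 0 ≤ ∑ i, ∑ j, y i * Q i j * y j
  exact (mul_nonneg_iff_of_pos_left hSpos).mp hSQ

/-- **Rounded twin shipped as PACKED rows, closeness in row ranges**: the packed rows DD certificate of
the twin (`Packed.checkRows` on the shipped row numerals `Arows`, no in-kernel packing), `mch` ranges
of `closeRangeP` covering the block, and the margin give the nonnegative quadratic form of
`matrixOfRows n n Qrows`. [cite: Rump1999VerifiedLargeSystems, §4 Algorithm 4.1 step 7] -/
theorem quadForm_nonneg_of_packedTwinRows_ranges {n w den v x O S s e k mch : ℕ}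
    {Qrows : List (List ℚ)} {Arows ds Crows : List ℕ}
    (hcheck : Packed.checkRows n w den v x O Arows ds Crows = true) (hS : 0 < S)
    (hranges : ∀ c : Fin mch, closeRangeP n w S s e (c.val * k) k Qrows Arows = true)
    (hcover : n ≤ mch * k) (hmargin : n * e ≤ s) (y : Fin n → R) :
    0 ≤ ∑ i, ∑ j, y i * ((matrixOfRows n n Qrows i j : ℚ) : R) * y j := by
  refine quadForm_nonneg_of_twinMatrix_of_close (Packed.isGramCertZ_of_checkRows hcheck) hS
    (fun i j => ?_) hmargin y
  have hk : 0 < k := by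
    rcases Nat.eq_zero_or_pos k with hk | hk
    · subst hk; have := i.isLt; omega
    · exact hk
  have hc : i.val / k < mch := by
    by_contra hnot
    rw [not_lt] at hnot
    have h1 : mch * k ≤ (i.val / k) * k := Nat.mul_le_mul_right k hnot
    have h2 : (i.val / k) * k ≤ i.val := Nat.div_mul_le_self i.val k
    have := i.isLt; omega
  refine closeRangeP_spec (hranges ⟨i.val / k, hc⟩) i j ?_ ?_
  · exact Nat.div_mul_le_self i.val k
  · have := Nat.lt_div_mul_add hk (a := i.val)
    simpa [Nat.mul_comm] using this

/-- **Rounded twin shipped as PACKED rows, everything split**: head + row ranges of the packed DD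
check (`Packed.checkRowsHead`, `Packed.RangesOK`), closeness ranges, margin.
[cite: Rump1999VerifiedLargeSystems, §4 Algorithm 4.1 step 7] -/
theorem quadForm_nonneg_of_packedTwinRows_split {n w den v x O S s e k mch : ℕ}
    {Qrows : List (List ℚ)} {Arows ds Crows cnts : List ℕ}
    (hhead : Packed.checkRowsHead n w den v x O Arows ds Crows = true)
    (hrows : Packed.RangesOK w v x O Arows ds Crows 0 cnts) (hcnts : n ≤ cnts.sum) (hS : 0 < S)
    (hranges : ∀ c : Fin mch, closeRangeP n w S s e (c.val * k) k Qrows Arows = true)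
    (hcover : n ≤ mch * k) (hmargin : n * e ≤ s) (y : Fin n → R) :
    0 ≤ ∑ i, ∑ j, y i * ((matrixOfRows n n Qrows i j : ℚ) : R) * y j := by
  refine quadForm_nonneg_of_twinMatrix_of_close (Packed.isGramCertZ_of_checkRowsRanges hhead hrows hcnts)
    hS (fun i j => ?_) hmargin y
  have hk : 0 < k := by
    rcases Nat.eq_zero_or_pos k with hk | hk
    · subst hk; have := i.isLt; omega
    · exact hk
  have hc : i.val / k < mch := by
    by_contra hnot
    rw [not_lt] at hnot
    have h1 : mch * k ≤ (i.val / k) * k := Nat.mul_le_mul_right k hnot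
    have h2 : (i.val / k) * k ≤ i.val := Nat.div_mul_le_self i.val k
    have := i.isLt; omega
  refine closeRangeP_spec (hranges ⟨i.val / k, hc⟩) i j ?_ ?_
  · exact Nat.div_mul_le_self i.val k
  · have := Nat.lt_div_mul_add hk (a := i.val)
    simpa [Nat.mul_comm] using this

end TwinMatrix

end PSD

namespace SOS

namespace GramL

variable {R : Type*} [Field R] [LinearOrder R] [IsStrictOrderedRing R]

/-- **Twin lane, PACKED twin rows, chunked closeness** — the emitters' cheap-transport shape: the
packed DD certificate of the twin row numerals (one decide), `mch` ranges of `PSD.closeRangeP` against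
the block's rows `g.Q`, margin ⇒ `QuadNonneg`. [cite: Rump1999VerifiedLargeSystems, §4 Algorithm 4.1 step 7] -/
theorem quadNonneg_of_packedTwinRows_ranges (g : GramL) {w den v x O S s e k mch : ℕ}
    {Arows ds Crows : List ℕ}
    (hcheck : PSD.Packed.checkRows g.s w den v x O Arows ds Crows = true) (hS : 0 < S)
    (hranges : ∀ c : Fin mch, PSD.closeRangeP g.s w S s e (c.val * k) k g.Q Arows = true)
    (hcover : g.s ≤ mch * k) (hmargin : g.s * e ≤ s) :
    g.toGramSOS.QuadNonneg R :=
  g.quadNonneg_of_quadForm fun y =>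
    PSD.quadForm_nonneg_of_packedTwinRows_ranges hcheck hS hranges hcover hmargin y

/-- **Twin lane, PACKED twin rows, everything split** (head + row ranges of the DD check, closeness
ranges). [cite: Rump1999VerifiedLargeSystems, §4 Algorithm 4.1 step 7] -/
theorem quadNonneg_of_packedTwinRows_split (g : GramL) {w den v x O S s e k mch : ℕ}
    {Arows ds Crows cnts : List ℕ}
    (hhead : PSD.Packed.checkRowsHead g.s w den v x O Arows ds Crows = true)
    (hrows : PSD.Packed.RangesOK w v x O Arows ds Crows 0 cnts) (hcnts : g.s ≤ cnts.sum) (hS : 0 < S)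
    (hranges : ∀ c : Fin mch, PSD.closeRangeP g.s w S s e (c.val * k) k g.Q Arows = true)
    (hcover : g.s ≤ mch * k) (hmargin : g.s * e ≤ s) :
    g.toGramSOS.QuadNonneg R :=
  g.quadNonneg_of_quadForm fun y =>
    PSD.quadForm_nonneg_of_packedTwinRows_split hhead hrows hcnts hS hranges hcover hmargin y

end GramL

/-! ### Kernel-checked example: the `2 × 2` block, twin rows shipped packed (`w = 4`: row numerals of
`M = [[6, −4], [−4, 6]]` with offset digits `6+8, −4+8 | −4+8, 6+8`, i.e. `0xE4 → 14 + 4·16 = 78`? — no: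
digit `j` sits at bits `w·j`, so row 0 = `(6+8) + (−4+8)·16 = 78`, row 1 = `(−4+8) + (6+8)·16 = 228`) -/

/-- Test: `QuadNonneg` over `ℝ` with the twin shipped as packed row numerals `[78, 228]`, its packed
DD certificate (factor `B = [[2, −2], [0, 1]]` columns, `d = [1, 1]`, `v = 3`, `x = 8`, `O = 3`),
closeness in two one-row ranges. -/
example : (GramL.toGramSOS ⟨[[1, 0], [0, 1]],
      [[(2 : ℚ) + 1 / 3 ^ 40, -1], [-1, (2 : ℚ) - 1 / 3 ^ 40]], [], []⟩).QuadNonneg ℝ :=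
  GramL.quadNonneg_of_packedTwinRows_ranges _ (w := 4) (den := 1) (v := 3) (x := 8) (O := 3)
    (S := 4) (s := 2) (e := 1) (k := 1) (mch := 2) (Arows := [78, 228]) (ds := [1, 1])
    (Crows := [[2, 0], [-2, 1]].map (PSD.Packed.packCol 3 3))
    (by decide +kernel) (by decide) (by intro c; fin_cases c <;> decide +kernel) (by decide) (by decide)

end SOS

/-! ## Uneven closeness ranges (APPEND 2026-08-27, certnum-sdp-3 g5)
`closeRangeP … lo k` with `lo + k > n` visits PHANTOM rows `i ≥ n` whose packed literal defaults to `0`,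
i.e. decodes to entries `−2^(w−1)` — so the equal-width assembly needs `k ∣ n` in practice. General
shape: CONSECUTIVE ranges of arbitrary widths covering `0 … n−1` (like `PSD.Packed.RangesOK`). -/

namespace PSD

/-- **Closeness range facts covering consecutive rows from `lo`**: `CloseRangesP … lo [c₀, c₁, …]` says
`closeRangeP … lo c₀ = true ∧ closeRangeP … (lo + c₀) c₁ = true ∧ …`. [folklore] -/
def CloseRangesP (n w S s e : ℕ) (Qrows : List (List ℚ)) (Arows : List ℕ) : ℕ → List ℕ → Prop
  | _, [] => True
  | lo, cnt :: rest => closeRangeP n w S s e lo cnt Qrows Arows = true ∧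
      CloseRangesP n w S s e Qrows Arows (lo + cnt) rest

/-- Semantics of `CloseRangesP`: every row index in `[lo, lo + Σ cnts)` (and `< n`) is entrywise close.
[cite: Rump1999VerifiedLargeSystems, §4 Algorithm 4.1 step 7] -/
theorem closeRangesP_spec {n w S s e : ℕ} {Qrows : List (List ℚ)} {Arows : List ℕ} :
    ∀ (cnts : List ℕ) (lo : ℕ), CloseRangesP n w S s e Qrows Arows lo cnts →
      ∀ i j : Fin n, lo ≤ i.val → i.val < lo + cnts.sum →
        |(S : ℚ) * matrixOfRows n n Qrows i j -
            (((Packed.intMatrixRows n w Arows i j : ℤ) : ℚ) + if i = j then (s : ℚ) else 0)| ≤ e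
  | [], lo, _, i, j, h1, h2 => by simp at h2; omega
  | cnt :: rest, lo, h, i, j, h1, h2 => by
      obtain ⟨hr, hrest⟩ := h
      by_cases hi : i.val < lo + cnt
      · exact closeRangeP_spec hr i j h1 hi
      · rw [List.sum_cons] at h2
        exact closeRangesP_spec rest (lo + cnt) hrest i j (by omega) (by omega)

/-- **Rounded twin shipped as PACKED rows, closeness in ranges of ANY widths** covering the block
(`CloseRangesP … 0 cnts`, `n ≤ Σ cnts`), packed DD certificate one piece, margin ⇒ nonnegative
quadratic form of `matrixOfRows n n Qrows`. [cite: Rump1999VerifiedLargeSystems, §4 Algorithm 4.1 step 7] -/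
theorem quadForm_nonneg_of_packedTwinRows_covers {R : Type*} [Field R] [LinearOrder R]
    [IsStrictOrderedRing R] {n w den v x O S s e : ℕ} {Qrows : List (List ℚ)}
    {Arows ds Crows ccnts : List ℕ} (hcheck : Packed.checkRows n w den v x O Arows ds Crows = true)
    (hS : 0 < S) (hclose : CloseRangesP n w S s e Qrows Arows 0 ccnts) (hccov : n ≤ ccnts.sum)
    (hmargin : n * e ≤ s) (y : Fin n → R) :
    0 ≤ ∑ i, ∑ j, y i * ((matrixOfRows n n Qrows i j : ℚ) : R) * y j :=
  quadForm_nonneg_of_twinMatrix_of_close (Packed.isGramCertZ_of_checkRows hcheck) hS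
    (fun i j => closeRangesP_spec ccnts 0 hclose i j (Nat.zero_le _) (by have := i.isLt; omega))
    hmargin y

end PSD

namespace SOS

/-- **Twin lane, PACKED twin rows, closeness ranges of any widths** (`PSD.CloseRangesP`, assembled by
`⟨h₀, h₁, …, trivial⟩`). [cite: Rump1999VerifiedLargeSystems, §4 Algorithm 4.1 step 7] -/
theorem GramL.quadNonneg_of_packedTwinRows_covers {R : Type*} [Field R] [LinearOrder R]
    [IsStrictOrderedRing R] (g : GramL) {w den v x O S s e : ℕ} {Arows ds Crows ccnts : List ℕ}
    (hcheck : PSD.Packed.checkRows g.s w den v x O Arows ds Crows = true) (hS : 0 < S)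
    (hclose : PSD.CloseRangesP g.s w S s e g.Q Arows 0 ccnts) (hccov : g.s ≤ ccnts.sum)
    (hmargin : g.s * e ≤ s) : g.toGramSOS.QuadNonneg R :=
  g.quadNonneg_of_quadForm fun y =>
    PSD.quadForm_nonneg_of_packedTwinRows_covers hcheck hS hclose hccov hmargin y

/-- Test: the `2 × 2` packed example through `CloseRangesP` with the exact cover `[1, 1]`. -/
example : (GramL.toGramSOS ⟨[[1, 0], [0, 1]],
      [[(2 : ℚ) + 1 / 3 ^ 40, -1], [-1, (2 : ℚ) - 1 / 3 ^ 40]], [], []⟩).QuadNonneg ℝ :=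
  GramL.quadNonneg_of_packedTwinRows_covers _ (w := 4) (den := 1) (v := 3) (x := 8) (O := 3)
    (S := 4) (s := 2) (e := 1) (Arows := [78, 228]) (ds := [1, 1])
    (Crows := [[2, 0], [-2, 1]].map (PSD.Packed.packCol 3 3)) (ccnts := [1, 1])
    (by decide +kernel) (by decide) ⟨by decide +kernel, by decide +kernel, trivial⟩ (by decide) (by decide)

end SOS

end Literature.Computation.Certificates
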